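import Mathlib
import HarnessLib
import Summits.ValiantsHypothesis.ValiantsHypothesis.Theses.MonotoneRestoration
import Literature.Computability.AlgebraicComplexity.ArithCircuit
import Literature.Computability.AlgebraicComplexity.ArithCircuitProofs
import Literature.Computability.AlgebraicComplexity.MonotoneStructure
import Literature.Computability.AlgebraicComplexity.PermanentIrreducible
import Literature.ModelTheory.FiniteModelTheory.CkEquiv
import Summits.ValiantsHypothesis.ValiantsHypothesis.Theorems.MonotoneRestorationMonotoneRestorationQPCosetCount
import Summits.ValiantsHypothesis.ValiantsHypothesis.Theorems.MonotoneRestorationMonotoneRestorationQPSymmetricLB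
import Summits.ValiantsHypothesis.ValiantsHypothesis.Theorems.MonotoneRestorationMonotoneRestorationQPSupportSymmetrisation
import Summits.ValiantsHypothesis.ValiantsHypothesis.Theorems.MonotoneRestorationMonotoneRestorationQPSparseRegime
import Summits.ValiantsHypothesis.ValiantsHypothesis.Theorems.MonotoneRestorationMonotoneRestorationQPBeta
import Literature.Computability.AlgebraicComplexity.SymmetricArithCircuit
import Literature.Computability.AlgebraicComplexity.DawarWilsenach2025Proofs
import Literature.GroupTheory.PermutationGroups.SmallIndexSubgroups
import Summits.ValiantsHypothesis.ValiantsHypothesis.Theorems.MonotoneRestorationQP.Negative.LoadBearing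
import Summits.ValiantsHypothesis.ValiantsHypothesis.Theorems.MonotoneRestorationMonotoneRestorationQPPermSupportCount

/-! TTRL-lite variant V18955 of stmt-ValiantsHypothesis-15886 -/

-- `Summit.ValiantsHypothesis.ValiantsHypothesis.…` is the tree's mandated single-conjunct layout
-- (Sub = Summit), so the duplicated namespace component is intended.
set_option linter.dupNamespace false

namespace Summit.ValiantsHypothesis.ValiantsHypothesis.Theorems

open Summit.ValiantsHypothesis.ValiantsHypothesis.Theses.MonotoneRestoration
open Literature.Computability.AlgebraicComplexity

/-- **TTRL-lite variant V18955** (`generalise`, boundary probe) of `stub_mulGate_children_extend`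
(item `stmt-ValiantsHypothesis-15886`) is FALSE: when the support of a product `p * q` translates
into `f.support`, each factor's support translates into `f.support` as well, but NOT by one COMMON
shift `μ` serving both factors — the shift for `p` must absorb a monomial of `q` and vice versa, so
it genuinely depends on the child.  Witness (one variable `v = (0,0)`, `n = 1`): `p = X v`,
`q = X v ^ 2`, `f = p * q = X v ^ 3` (product shift `0`); a common `μ` would need
`single v 1 + μ = single v 3 = single v 2 + μ`, i.e. `single v 1 = single v 2`, i.e. `1 = 2`. -/
theorem stub_mulGate_children_extend_var18955_false :
    ¬ (∀ (n : ℕ) (p q f : MvPolynomial (Fin n × Fin n) NNReal), p * q ≠ 0 →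
        (∃ μ : (Fin n × Fin n) →₀ ℕ, ∀ m ∈ (p * q).support, m + μ ∈ f.support) →
        ∃ μ : (Fin n × Fin n) →₀ ℕ, (∀ m ∈ p.support, m + μ ∈ f.support) ∧
          (∀ m ∈ q.support, m + μ ∈ f.support)) := by
  intro h
  -- the witness: `n = 1`, `v = (0, 0)`, `p = X v`, `q = X v ^ 2`, `f = p * q = X v ^ 3`
  have hpq : (MvPolynomial.X ((0, 0) : Fin 1 × Fin 1) : MvPolynomial (Fin 1 × Fin 1) NNReal) *
      MvPolynomial.X (0, 0) ^ 2 = MvPolynomial.monomial (Finsupp.single (0, 0) 3) 1 := by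
    rw [← pow_succ', MvPolynomial.X_pow_eq_monomial]
  have hne : (MvPolynomial.X ((0, 0) : Fin 1 × Fin 1) : MvPolynomial (Fin 1 × Fin 1) NNReal) *
      MvPolynomial.X (0, 0) ^ 2 ≠ 0 := by
    rw [hpq]
    exact (MvPolynomial.monomial_eq_zero).not.mpr one_ne_zero
  have h1 : Finsupp.single ((0, 0) : Fin 1 × Fin 1) 1 ∈
      (MvPolynomial.X ((0, 0) : Fin 1 × Fin 1) : MvPolynomial (Fin 1 × Fin 1) NNReal).support := by
    rw [MvPolynomial.support_X]
    exact Finset.mem_singleton_self _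
  have h2 : Finsupp.single ((0, 0) : Fin 1 × Fin 1) 2 ∈
      (MvPolynomial.X ((0, 0) : Fin 1 × Fin 1) ^ 2 : MvPolynomial (Fin 1 × Fin 1) NNReal).support := by
    rw [MvPolynomial.X_pow_eq_monomial, MvPolynomial.mem_support_iff, MvPolynomial.coeff_monomial,
      if_pos rfl]
    exact one_ne_zero
  obtain ⟨μ, hp, hq⟩ := h 1 (MvPolynomial.X (0, 0)) (MvPolynomial.X (0, 0) ^ 2)
    (MvPolynomial.X (0, 0) * MvPolynomial.X (0, 0) ^ 2) hne ⟨0, fun m hm => by rwa [add_zero]⟩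
  have k1 := hp _ h1
  have k2 := hq _ h2
  rw [hpq, MvPolynomial.mem_support_iff, MvPolynomial.coeff_monomial, Ne, ite_eq_right_iff,
    Classical.not_imp] at k1 k2
  -- k1 : single v 3 = single v 1 + μ ∧ ¬ (1 = 0);  k2 : single v 3 = single v 2 + μ ∧ ¬ (1 = 0)
  have e : Finsupp.single ((0, 0) : Fin 1 × Fin 1) 1 = Finsupp.single ((0, 0) : Fin 1 × Fin 1) 2 :=
    add_right_cancel (k1.1.symm.trans k2.1)
  have := Finsupp.single_injective ((0, 0) : Fin 1 × Fin 1) e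
  omega

end Summit.ValiantsHypothesis.ValiantsHypothesis.Theorems
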